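import Summits.CriticalPhenomena.PercolationContinuityZ3.Theorems.PercNearOneGluingNoHeavyPcintMemUniformTen
import Summits.CriticalPhenomena.PercolationContinuityZ3.Theorems.PercNearOneGluingNoHeavyPcintClosingDecagonsExactAll
import Summits.CriticalPhenomena.PercolationContinuityZ3.Theorems.PercNearOneGluingNoHeavyPcintRungEightBrackets
import HarnessLib

/-!
# CriticalPhenomena/PercolationContinuityZ3 — Theorems/PercNearOneGluingNoHeavyPcintRungTenBrackets.lean: `R_8(d)` and `R_10(d)` between ratios of INTEGER POLYNOMIALS in `d` of MODERATE degree (every `d ≥ 6`)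

Lane prim-pcint, STRUCTURE rule (prim-pcint-2 GEN 19; part 1 of the fourth-rung dimension law, part 3 = …LoopExclusionRungTenDimension).
Refinement of …RungEightBrackets: in `R_τ ≤ (U/L' − 1)·V^τ/C` and `R_τ ≥ (1 − U'/L)·W^τ/C` the SHARP uniform certificates (`μ_8`: K = 7,
…MemUniformEight; `μ_10`: K = 9, …MemUniformTen; `μ_6`: K = 7) are used only in the first factor, while the power `μ_{τ−2}^τ` is bracketed by
COARSE low-degree bounds `V, W` (`σ − 1 − 1/σ − 3/σ² ≥ μ_8`, `σ − 1 − 1/σ − 3/σ² − 17/σ³ ≤ μ_8`, `… + 12/σ³ ≥ μ_6 ≥ … + 11/σ³`, `σ = 2d`, all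
certified against the sharp brackets from `d ≥ 5`), so that the kernel certificates of part 3 have degree ≤ 80 instead of ≈ 190:
`loopCompat_le_of_brackets'` / `ge_of_brackets'` (any rung); **`loopCompat_ten_le_peval` / `ge_peval`** (`NL10/DL10 ≤ R_10(d) ≤ NU10/DE10`,
degrees 45/45 and 35/35) and **`loopCompat_eight_le_pevalC` / `ge_pevalC`** (`NL8c/DL8c ≤ R_8(d) ≤ NU8c/DE8c`, degrees 36/36), `d ≥ 6`.

HONEST FRAMING: bracket arithmetic.  No `sorry`; standard axioms.  Generated by numerics/gen_u10law.py.  Written by prim-pcint-2 gen 19, 2026-08-26.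
-/

noncomputable section

open Filter Topology
open Literature.Probability.LatticeModels Literature.Probability.Percolation
open Summit.CriticalPhenomena.PercolationContinuityZ3.Theorems.Pcint
open Summit.CriticalPhenomena.PercolationContinuityZ3.Theorems.Pcint.PolyCert

namespace Summit.CriticalPhenomena.PercolationContinuityZ3.Theorems.Pcint.MemoryTail

variable {d : ℕ}

/-! ### Bracket bounds with a separate coarse power factor -/

/-- **Upper bound of `R_τ`**: `μ_{τ−2} ≤ U`, `μ_{τ−2} ≤ V`, `0 < L' ≤ μ_τ`, `2τ p_τ = C > 0` give `R_τ ≤ (U/L' − 1)·V^τ/C`. [folklore] -/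
theorem loopCompat_le_of_brackets' [NeZero d] {τ : ℕ} {U V Lc C : ℝ} (hU : memGrowth d (τ - 2) ≤ U) (hV : memGrowth d (τ - 2) ≤ V)
    (hLc : Lc ≤ memGrowth d τ) (hLcpos : 0 < Lc) (hC : (closingCount d τ : ℝ) = C) (hCpos : 0 < C) :
    loopCompat d τ ≤ (U / Lc - 1) * V ^ τ / C := by
  have hμp : 0 < memGrowth d (τ - 2) := memGrowth_pos _
  have hμc : 0 < memGrowth d τ := memGrowth_pos _
  have hΔ0 : 0 ≤ memLoopCost d τ := memLoopCost_nonneg τ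
  have hΔ : memLoopCost d τ ≤ U / Lc - 1 := by
    unfold memLoopCost
    have hq : 0 < memGrowth d (τ - 2) / memGrowth d τ := div_pos hμp hμc
    have h1 := Real.log_le_sub_one_of_pos hq
    have h2 : memGrowth d (τ - 2) / memGrowth d τ ≤ U / Lc := div_le_div₀ (hμp.le.trans hU) hU hLcpos hLc
    linarith
  have hf : memLoopDensity d τ = C / memGrowth d (τ - 2) ^ τ := by unfold memLoopDensity; rw [hC]
  have hμpow : 0 < memGrowth d (τ - 2) ^ τ := pow_pos hμp τ
  have hfpos : 0 < memLoopDensity d τ := by rw [hf]; positivity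
  unfold loopCompat
  rw [div_le_iff₀ hfpos, hf]
  have hpow : memGrowth d (τ - 2) ^ τ ≤ V ^ τ := pow_le_pow_left₀ hμp.le hV τ
  have halg : (U / Lc - 1) * V ^ τ / C * (C / memGrowth d (τ - 2) ^ τ) = (U / Lc - 1) * (V ^ τ / memGrowth d (τ - 2) ^ τ) := by
    field_simp
  rw [halg]
  have hratio : 1 ≤ V ^ τ / memGrowth d (τ - 2) ^ τ := by rw [le_div_iff₀ hμpow]; linarith
  have hnn : 0 ≤ U / Lc - 1 := le_trans hΔ0 hΔ
  nlinarith [mul_le_mul_of_nonneg_left hratio hnn]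

/-- **Lower bound of `R_τ`**: `0 < L ≤ μ_{τ−2}`, `0 < W ≤ μ_{τ−2}`, `μ_τ ≤ U'`, `2τ p_τ = C > 0` give `(1 − U'/L)·W^τ/C ≤ R_τ`. [folklore] -/
theorem loopCompat_ge_of_brackets' [NeZero d] {τ : ℕ} {Lp W Uc C : ℝ} (hLp : Lp ≤ memGrowth d (τ - 2)) (hLppos : 0 < Lp)
    (hW : W ≤ memGrowth d (τ - 2)) (hWpos : 0 < W) (hUc : memGrowth d τ ≤ Uc) (hC : (closingCount d τ : ℝ) = C) (hCpos : 0 < C) :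
    (1 - Uc / Lp) * W ^ τ / C ≤ loopCompat d τ := by
  have hμp : 0 < memGrowth d (τ - 2) := memGrowth_pos _
  have hμc : 0 < memGrowth d τ := memGrowth_pos _
  have hR0 : 0 ≤ loopCompat d τ := loopCompat_nonneg τ
  have hWpow : 0 ≤ W ^ τ := pow_nonneg hWpos.le τ
  by_cases hs : 1 - Uc / Lp ≤ 0
  · have h1 : (1 - Uc / Lp) * W ^ τ ≤ 0 * C := by nlinarith
    have := (div_le_iff₀ hCpos).2 h1
    linarith
  · push Not at hs
    have hΔ : 1 - Uc / Lp ≤ memLoopCost d τ := by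
      unfold memLoopCost
      have hq : 0 < memGrowth d (τ - 2) / memGrowth d τ := div_pos hμp hμc
      have h1 := Real.one_sub_inv_le_log_of_pos hq
      rw [inv_div] at h1
      have h2 : memGrowth d τ / memGrowth d (τ - 2) ≤ Uc / Lp := div_le_div₀ (hμc.le.trans hUc) hUc hLppos hLp
      linarith
    have hf : memLoopDensity d τ = C / memGrowth d (τ - 2) ^ τ := by unfold memLoopDensity; rw [hC]
    have hμpow : 0 < memGrowth d (τ - 2) ^ τ := pow_pos hμp τ
    have hfpos : 0 < memLoopDensity d τ := by rw [hf]; positivity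
    unfold loopCompat
    rw [le_div_iff₀ hfpos, hf]
    have hpow : W ^ τ ≤ memGrowth d (τ - 2) ^ τ := pow_le_pow_left₀ hWpos.le hW τ
    have halg : (1 - Uc / Lp) * W ^ τ / C * (C / memGrowth d (τ - 2) ^ τ) = (1 - Uc / Lp) * (W ^ τ / memGrowth d (τ - 2) ^ τ) := by
      field_simp
    rw [halg]
    have hratio : W ^ τ / memGrowth d (τ - 2) ^ τ ≤ 1 := by rw [div_le_iff₀ hμpow]; linarith
    have hΔ0 : 0 ≤ memLoopCost d τ := memLoopCost_nonneg τ
    nlinarith [mul_le_mul_of_nonneg_left hratio hs.le, div_nonneg hWpow hμpow.le]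

/-! ### Coarse brackets of `μ_6`, `μ_8` and the polynomial data -/

/-- `(2d)^9` as a coefficient list. [folklore] -/
def D9L : List ℤ := [0, 0, 0, 0, 0, 0, 0, 0, 0, 512]
/-- `peval D9L d = (2d)^9`. [folklore] -/
theorem peval_D9L (x : ℝ) : peval D9L x = (2 * x) ^ 9 := by simp [D9L, peval]; ring
/-- `(2d)²`. [folklore] -/
def S2L : List ℤ := [0, 0, 4]
/-- `peval S2L d = (2d)²`. [folklore] -/
theorem peval_S2L (x : ℝ) : peval S2L x = (2 * x) ^ 2 := by simp [S2L, peval]; ring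
/-- `2·10·p_10(ℤ^d) = 7936d⁵ − 60080d⁴ + 169840d³ − 207720d² + 90024d`. [folklore] -/
def cc10L : List ℤ := [0, 90024, -207720, 169840, -60080, 7936]
/-- `2·10·p_10(ℤ^d)` in `peval` form (`d ≥ 6`). [folklore] -/
theorem cc10_peval (hd : 6 ≤ d) : (closingCount d 10 : ℝ) = peval cc10L d := by
  rw [closingCount_ten_eq_real hd]; simp [cc10L, peval]; ring
/-- Numerator of the coarse upper bound `σ − 1 − 1/σ − 3/σ²` of `μ_8` (`σ = 2d`): `8d³ − 4d² − 2d − 3`. [folklore] -/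
def P8hi : List ℤ := [-3, -2, -4, 8]
/-- Its denominator `4d²`. [folklore] -/
def Q8hi : List ℤ := [0, 0, 4]
/-- Numerator of the coarse lower bound `σ − 1 − 1/σ − 3/σ² − 17/σ³` of `μ_8`. [folklore] -/
def P8lo : List ℤ := [-17, -6, -4, -8, 16]
/-- Its denominator `8d³`. [folklore] -/
def Q8lo : List ℤ := [0, 0, 0, 8]
/-- Numerator of the coarse upper bound `σ − 1 − 1/σ − 3/σ² + 12/σ³` of `μ_6`. [folklore] -/
def P6hi : List ℤ := [12, -6, -4, -8, 16]
/-- Its denominator `8d³`. [folklore] -/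
def Q6hi : List ℤ := [0, 0, 0, 8]
/-- Numerator of the coarse lower bound `σ − 1 − 1/σ − 3/σ² + 11/σ³` of `μ_6`. [folklore] -/
def P6lo : List ℤ := [11, -6, -4, -8, 16]
/-- Its denominator `8d³`. [folklore] -/
def Q6lo : List ℤ := [0, 0, 0, 8]

/-- Comparison of two fractions from a polynomial certificate: `A/B ≤ P/Q` if `0 ≤ P·B − A·Q`, `B, Q > 0`. [folklore] -/
theorem div_le_div_of_cert {A B Pn Qn : List ℤ} {c : ℤ} (h : allNonneg (pshift (psub (pmul Pn B) (pmul A Qn)) c) = true) {x : ℝ}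
    (hx : (c : ℝ) ≤ x) (hB : 0 < peval B x) (hQ : 0 < peval Qn x) : peval A x / peval B x ≤ peval Pn x / peval Qn x := by
  have h0 := peval_nonneg_of_shift h hx
  rw [peval_psub, peval_pmul, peval_pmul] at h0
  rw [div_le_div_iff₀ hB hQ]; linarith

/-- `μ_8(d) ≤ P8hi(d)/Q8hi(d)` for `d ≥ 5`. [folklore] -/
theorem mu8_le_coarse (hd : 5 ≤ d) : memGrowth d 8 ≤ peval P8hi d / peval Q8hi d := by
  have hd' : (5 : ℝ) ≤ d := by exact_mod_cast hd
  have hD7 : 0 < peval D7L d := by rw [peval_D7L]; positivity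
  have hQ : 0 < peval Q8hi d := by simp [Q8hi, peval]; positivity
  exact (mu8_bounds_peval hd).2.trans (div_le_div_of_cert (c := 5) (by decide +kernel) hd' hD7 hQ)

/-- `P8lo(d)/Q8lo(d) ≤ μ_8(d)` for `d ≥ 5`. [folklore] -/
theorem mu8_ge_coarse (hd : 5 ≤ d) : peval P8lo d / peval Q8lo d ≤ memGrowth d 8 := by
  have hd' : (5 : ℝ) ≤ d := by exact_mod_cast hd
  have hD7 : 0 < peval D7L d := by rw [peval_D7L]; positivity
  have hQ : 0 < peval Q8lo d := by simp [Q8lo, peval]; positivity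
  exact (div_le_div_of_cert (c := 5) (by decide +kernel) hd' hQ hD7).trans (mu8_bounds_peval hd).1

/-- `μ_6(d) ≤ P6hi(d)/Q6hi(d)` for `d ≥ 5`. [folklore] -/
theorem mu6_le_coarse (hd : 5 ≤ d) : memGrowth d 6 ≤ peval P6hi d / peval Q6hi d := by
  have hd' : (5 : ℝ) ≤ d := by exact_mod_cast hd
  have hD7 : 0 < peval D7L d := by rw [peval_D7L]; positivity
  have hQ : 0 < peval Q6hi d := by simp [Q6hi, peval]; positivity
  exact (mu6_le_peval (by omega)).trans (div_le_div_of_cert (c := 5) (by decide +kernel) hd' hD7 hQ)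

/-- `P6lo(d)/Q6lo(d) ≤ μ_6(d)` for `d ≥ 5`. [folklore] -/
theorem mu6_ge_coarse (hd : 5 ≤ d) : peval P6lo d / peval Q6lo d ≤ memGrowth d 6 := by
  have hd' : (5 : ℝ) ≤ d := by exact_mod_cast hd
  have hD7 : 0 < peval D7L d := by rw [peval_D7L]; positivity
  have hQ : 0 < peval Q6lo d := by simp [Q6lo, peval]; positivity
  exact (div_le_div_of_cert (c := 5) (by decide +kernel) hd' hQ hD7).trans (mu6_ge_peval (by omega))

/-- `μ_10(d)` two-sided in `peval` form with the list denominator (`d ≥ 6`). [folklore] -/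
theorem mu10_bounds_peval (hd : 6 ≤ d) :
    peval num10Lo d / peval D9L d ≤ memGrowth d 10 ∧ memGrowth d 10 ≤ peval num10Hi d / peval D9L d := by
  rw [peval_D9L]; exact memGrowth_ten_bounds_peval hd

/-! ### `R_10` and `R_8` between ratios of integer polynomials -/

/-- Numerator of the upper bound of `R_10` (degree 35). [folklore] -/
def NU10 : List ℤ := pmul (psub (pmul S2L num8Hi) num10Lo) (ppow P8hi 10)
/-- Denominator of the upper bound of `R_10`. [folklore] -/
def DE10 : List ℤ := pmul (pmul num10Lo (ppow Q8hi 10)) cc10L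
/-- Numerator of the lower bound of `R_10` (degree 45). [folklore] -/
def NL10 : List ℤ := pmul (psub (pmul S2L num8Lo) num10Hi) (ppow P8lo 10)
/-- Denominator of the lower bound of `R_10`. [folklore] -/
def DL10 : List ℤ := pmul (pmul (pmul S2L num8Lo) (ppow Q8lo 10)) cc10L
/-- Numerator of the coarse-power upper bound of `R_8` (degree 36). [folklore] -/
def NU8c : List ℤ := pmul (psub n6hiL num8Lo) (ppow P6hi 8)
/-- Denominator of the coarse-power upper bound of `R_8`. [folklore] -/
def DE8c : List ℤ := pmul (pmul num8Lo (ppow Q6hi 8)) cc8L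
/-- Numerator of the coarse-power lower bound of `R_8`. [folklore] -/
def NL8c : List ℤ := pmul (psub n6loL num8Hi) (ppow P6lo 8)
/-- Denominator of the coarse-power lower bound of `R_8`. [folklore] -/
def DL8c : List ℤ := pmul (pmul n6loL (ppow Q6lo 8)) cc8L

/-- Positivity of `DE10` for `d ≥ 6`. [folklore] -/
theorem DE10_pos (hd : 6 ≤ d) : 0 < peval DE10 d := peval_pos_of_shift (c := 6) (by decide +kernel) (by exact_mod_cast hd)
/-- Positivity of `DL10` for `d ≥ 6`. [folklore] -/
theorem DL10_pos (hd : 6 ≤ d) : 0 < peval DL10 d := peval_pos_of_shift (c := 6) (by decide +kernel) (by exact_mod_cast hd)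
/-- Positivity of `DE8c` for `d ≥ 6`. [folklore] -/
theorem DE8c_pos (hd : 6 ≤ d) : 0 < peval DE8c d := peval_pos_of_shift (c := 6) (by decide +kernel) (by exact_mod_cast hd)
/-- Positivity of `DL8c` for `d ≥ 6`. [folklore] -/
theorem DL8c_pos (hd : 6 ≤ d) : 0 < peval DL8c d := peval_pos_of_shift (c := 6) (by decide +kernel) (by exact_mod_cast hd)

/-- **`R_10(d) ≤ NU10(d)/DE10(d)`** for every `d ≥ 6`. [folklore] -/
theorem loopCompat_ten_le_peval (hd : 6 ≤ d) : loopCompat d 10 ≤ peval NU10 d / peval DE10 d := by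
  haveI : NeZero d := ⟨by omega⟩
  have hd0 : (0 : ℝ) < d := by exact_mod_cast (show 0 < d by omega)
  have hd5 : (5 : ℝ) ≤ d := by exact_mod_cast (show 5 ≤ d by omega)
  have hB : 0 < peval num10Lo d := num10Lo_pos hd5
  have hQ : 0 < peval Q8hi d := by simp [Q8hi, peval]; positivity
  have hC : 0 < peval cc10L d := by
    rw [← cc10_peval hd]; exact_mod_cast closingCount_even_pos (d := d) (by omega) (m := 5) (by norm_num)
  have hLc : 0 < peval num10Lo d / peval D9L d := by rw [peval_D9L]; positivity
  have h := loopCompat_le_of_brackets' (τ := 10) (mu8_bounds_peval (by omega)).2 (mu8_le_coarse (by omega)) (mu10_bounds_peval hd).1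
    hLc (cc10_peval hd) hC
  have e : (peval num8Hi d / peval D7L d / (peval num10Lo d / peval D9L d) - 1) * (peval P8hi d / peval Q8hi d) ^ 10 / peval cc10L d
      = peval NU10 d / peval DE10 d := by
    simp only [NU10, DE10, peval_pmul, peval_psub, peval_ppow, peval_D7L, peval_D9L, peval_S2L]
    field_simp
  rwa [e] at h

/-- **`NL10(d)/DL10(d) ≤ R_10(d)`** for every `d ≥ 6`. [folklore] -/
theorem loopCompat_ten_ge_peval (hd : 6 ≤ d) : peval NL10 d / peval DL10 d ≤ loopCompat d 10 := by
  haveI : NeZero d := ⟨by omega⟩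
  have hd0 : (0 : ℝ) < d := by exact_mod_cast (show 0 < d by omega)
  have hd5 : (5 : ℝ) ≤ d := by exact_mod_cast (show 5 ≤ d by omega)
  have hA : 0 < peval num8Lo d := num8Lo_pos hd5
  have hP : 0 < peval P8lo d := peval_pos_of_shift (c := 5) (by decide +kernel) hd5
  have hQ : 0 < peval Q8lo d := by simp [Q8lo, peval]; positivity
  have hC : 0 < peval cc10L d := by
    rw [← cc10_peval hd]; exact_mod_cast closingCount_even_pos (d := d) (by omega) (m := 5) (by norm_num)
  have hLp : 0 < peval num8Lo d / peval D7L d := by rw [peval_D7L]; positivity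
  have h := loopCompat_ge_of_brackets' (τ := 10) (mu8_bounds_peval (by omega)).1 hLp (mu8_ge_coarse (by omega)) (div_pos hP hQ)
    (mu10_bounds_peval hd).2 (cc10_peval hd) hC
  have e : (1 - peval num10Hi d / peval D9L d / (peval num8Lo d / peval D7L d)) * (peval P8lo d / peval Q8lo d) ^ 10 / peval cc10L d
      = peval NL10 d / peval DL10 d := by
    simp only [NL10, DL10, peval_pmul, peval_psub, peval_ppow, peval_D7L, peval_D9L, peval_S2L]
    field_simp
  rwa [e] at h

/-- **`R_8(d) ≤ NU8c(d)/DE8c(d)`** for every `d ≥ 6`. [folklore] -/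
theorem loopCompat_eight_le_pevalC (hd : 6 ≤ d) : loopCompat d 8 ≤ peval NU8c d / peval DE8c d := by
  haveI : NeZero d := ⟨by omega⟩
  have hd0 : (0 : ℝ) < d := by exact_mod_cast (show 0 < d by omega)
  have hd5 : (5 : ℝ) ≤ d := by exact_mod_cast (show 5 ≤ d by omega)
  have hB : 0 < peval num8Lo d := num8Lo_pos hd5
  have hQ : 0 < peval Q6hi d := by simp [Q6hi, peval]; positivity
  have hC : 0 < peval cc8L d := by
    rw [← cc8_peval (by omega)]; exact_mod_cast closingCount_even_pos (d := d) (by omega) (m := 4) (by norm_num)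
  have hLc : 0 < peval num8Lo d / peval D7L d := by rw [peval_D7L]; positivity
  have h := loopCompat_le_of_brackets' (τ := 8) (mu6_le_peval (by omega)) (mu6_le_coarse (by omega)) (mu8_bounds_peval (by omega)).1
    hLc (cc8_peval (by omega)) hC
  have hD7 : peval D7L d ≠ 0 := by rw [peval_D7L]; positivity
  have e : (peval n6hiL d / peval D7L d / (peval num8Lo d / peval D7L d) - 1) * (peval P6hi d / peval Q6hi d) ^ 8 / peval cc8L d
      = peval NU8c d / peval DE8c d := by
    simp only [NU8c, DE8c, peval_pmul, peval_psub, peval_ppow]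
    field_simp
  rwa [e] at h

/-- **`NL8c(d)/DL8c(d) ≤ R_8(d)`** for every `d ≥ 6`. [folklore] -/
theorem loopCompat_eight_ge_pevalC (hd : 6 ≤ d) : peval NL8c d / peval DL8c d ≤ loopCompat d 8 := by
  haveI : NeZero d := ⟨by omega⟩
  have hd0 : (0 : ℝ) < d := by exact_mod_cast (show 0 < d by omega)
  have hd5 : (5 : ℝ) ≤ d := by exact_mod_cast (show 5 ≤ d by omega)
  have hA : 0 < peval n6loL d :=
    peval_pos_of_shift (p := n6loL) (c := 4) (by decide +kernel) (by exact_mod_cast (show 4 ≤ d by omega))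
  have hP : 0 < peval P6lo d := peval_pos_of_shift (c := 5) (by decide +kernel) hd5
  have hQ : 0 < peval Q6lo d := by simp [Q6lo, peval]; positivity
  have hC : 0 < peval cc8L d := by
    rw [← cc8_peval (by omega)]; exact_mod_cast closingCount_even_pos (d := d) (by omega) (m := 4) (by norm_num)
  have hLp : 0 < peval n6loL d / peval D7L d := by rw [peval_D7L]; positivity
  have h := loopCompat_ge_of_brackets' (τ := 8) (mu6_ge_peval (by omega)) hLp (mu6_ge_coarse (by omega)) (div_pos hP hQ)
    (mu8_bounds_peval (by omega)).2 (cc8_peval (by omega)) hC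
  have hD7 : peval D7L d ≠ 0 := by rw [peval_D7L]; positivity
  have e : (1 - peval num8Hi d / peval D7L d / (peval n6loL d / peval D7L d)) * (peval P6lo d / peval Q6lo d) ^ 8 / peval cc8L d
      = peval NL8c d / peval DL8c d := by
    simp only [NL8c, DL8c, peval_pmul, peval_psub, peval_ppow]
    field_simp
  rwa [e] at h

end Summit.CriticalPhenomena.PercolationContinuityZ3.Theorems.Pcint.MemoryTail
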